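import Literature.Computability.AlgebraicComplexity.BorderRankCW
import Literature.Computability.AlgebraicComplexity.KoszulBorderRank
import Literature.Computability.AlgebraicComplexity.BorderRankRestriction
import Literature.Computability.AlgebraicComplexity.TensorRestrictionRank
import HarnessLib

/-!
# Proof of CGLV 2022, Prop. 3.1: `bR(T_{skewcw,q}) ≥ q + 3`, and `bR(T_{skewcw,2}) = 5`
(discharge of `CGLV2022_prop31`)

Topic `Literature/Computability/AlgebraicComplexity`; companion of `BorderRankCW.lean`, whose named
fact `CGLV2022_prop31` — for every `u ≥ 1`, `2u + 3 ≤ bR(T_{skewcw,2u})`, and `bR(T_{skewcw,2}) = 5`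
(A. Conner, F. Gesmundo, J. M. Landsberg, E. Ventura, *Rank and border rank of Kronecker powers of
tensors and Strassen's laser method*, comput. complexity 31 (2022), arXiv:1909.04785: Prop. 3.1 =
arXiv Prop. 2.6, proof in §4.1 "Proof of Proposition (skewbad)"; `bR(T_{skewcw,2}) = 5` in §2.2 /
§1.3) — is PROVED here, for the tree's algebraic border rank `algBorderRank` over `ℂ[ε]`:
`CGLV2022_prop31_holds`.

## The proof

* **The `p = 1` Koszul flattening in block form** (`koszulBlock₁`, Strassen's equations in
  Ottaviani's form): on rows `e₁∧e₂, e₀∧e₂, e₀∧e₁` and columns `e₀, e₁, e₂` the tree's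
  `koszulFlattening 1 id t` is the block matrix of transposed slices `[[0,-T₂,T₁],[-T₂,0,T₀],[-T₁,T₀,0]]`
  (`koszulFlattening_one_submatrix`), so by the border-rank Koszul bound
  `rank T_{A'}^{∧1} ≤ binom(2,1) bR` (`KoszulBorderRank.lean`) and monotonicity of `bR` under
  restriction (`BorderRankRestriction.lean`) its rank is `≤ 2 bR(t')` for every `t' ≥ t`
  (`rank_koszulBlock₁_le_two_mul_algBorderRank`).
* **Lower bound** (the printed proof, §4.1): CGLV project `A = ℂ^{q+1} → A' = ⟨e₀,e₁,e₂⟩`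
  (`a₀ ↦ e₀`, `a_i ↦ e₁` for `i ≤ u`, `a_i ↦ e₂` for `i > u`) and show `rank T_{A'}^{∧1} ≥ 2q + 5`,
  whence `bR(T) ≥ ⌈(2q+5)/2⌉ = q + 3` (their eq. (5)). We use the coordinate restriction to the three
  rows `a₀, a₁, a_{u+1}` instead of the projection; the same image computation goes through: the
  column span of the block matrix of the three slices contains the `2q+5` basis vectors
  `(e₁∧e₂) ⊗ {c₀, c₁, c_{u+1}}`, `(e₀∧e₂) ⊗ c_j`, `(e₀∧e₁) ⊗ c_j` (`rank_skewKoszul_ge`). Indices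
  `{0,…,2u}` are handled through the split `SkewIdx u = {0} ⊔ {1,…,u} ⊔ {u+1,…,2u}` (`skewEmb`), on
  which `T_{skewcw,q}` is given by pattern matching (`skewCwTensor_rowSel_emb`). Valid over any field
  with `2 ≠ 0` (`add_three_le_algBorderRank_skewCwTensor`).
* **Upper bound** `bR(T_{skewcw,2}) ≤ 5`: CGLV invoke "for all `T ∈ ℂ³⊗ℂ³⊗ℂ³`, `bR(T) ≤ 5`"; we give
  instead an explicit five-term RANK decomposition of `T_{skewcw,2}` (`skewCwTensor_one_eq_sum`,
  integer entries, checked entrywise), so `bR ≤ R ≤ 5`.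

## References

* A. Conner, F. Gesmundo, J. M. Landsberg, E. Ventura, comput. complexity 31 (2022) =
  arXiv:1909.04785: eq. (3) (`T_{skewcw,q}`), Prop. 3.1 (arXiv Prop. 2.6), §4.1 (Koszul
  flattenings, eq. (5), proof of Prop. 3.1), §2.2 (`bR(T_{skewcw,2}) = 5`).
  [ConnerGesmundoLandsbergVentura2022]
* J. M. Landsberg, G. Ottaviani, Theory of Computing 11 (2015), Thm. 2.1 (`KoszulBorderRank.lean`).
  [LandsbergOttaviani2015]
-/

noncomputable section

open scoped BigOperators Matrix
open Module Submodule

namespace Literature.Computability.AlgebraicComplexity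

universe u v v' w w'

/-! ## The case `p = 1`: Strassen's equations as a `3 × 3` block matrix of slices -/

section StrassenBlock

variable {R : Type*} [CommRing R] {κ μ : Type*}

/-- The rows `e₁∧e₂, e₀∧e₂, e₀∧e₁` of `Λ²K³` (the complements of `e₀, e₁, e₂`; a bijection
`Fin 3 → PSub 3 2`, used only as a map). [folklore] -/
def koszulRow₁ : Fin 3 → PSub 3 2 :=
  ![⟨{1, 2}, by decide⟩, ⟨{0, 2}, by decide⟩, ⟨{0, 1}, by decide⟩]

/-- The columns `e₀, e₁, e₂` of `Λ¹K³ = K³` (a bijection `Fin 3 → PSub 3 1`). [folklore] -/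
def koszulCol₁ (i : Fin 3) : PSub 3 1 :=
  ⟨{i}, Finset.card_singleton i⟩

/-- The `p = 1` Koszul flattening as a `3 × 3` block matrix of transposed slices `T_i = t(i,·,·)`:
on rows `e₁∧e₂, e₀∧e₂, e₀∧e₁` and columns `e₀, e₁, e₂` it is
`[[0, -T₂, T₁], [-T₂, 0, T₀], [-T₁, T₀, 0]]` (Strassen's equations in Ottaviani's form
`a_i ∧ ·`; CGLV §4.1: "The case `p = 1` is equivalent to Strassen's equations").
[cite: ConnerGesmundoLandsbergVentura2022, §4.1] -/
def koszulBlock₁ (t : Fin 3 → κ → μ → R) : Matrix (Fin 3 × μ) (Fin 3 × κ) R :=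
  Matrix.of fun r c =>
    ![![0, -t 2 c.2 r.2, t 1 c.2 r.2],
      ![-t 2 c.2 r.2, 0, t 0 c.2 r.2],
      ![-t 1 c.2 r.2, t 0 c.2 r.2, 0]] r.1 c.1

/-- Entries of the block form. [cite: ConnerGesmundoLandsbergVentura2022, §4.1] -/
theorem koszulBlock₁_apply (t : Fin 3 → κ → μ → R) (r : Fin 3 × μ) (c : Fin 3 × κ) :
    koszulBlock₁ t r c =
      ![![0, -t 2 c.2 r.2, t 1 c.2 r.2],
        ![-t 2 c.2 r.2, 0, t 0 c.2 r.2],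
        ![-t 1 c.2 r.2, t 0 c.2 r.2, 0]] r.1 c.1 := rfl

/-- The block form is the submatrix of `koszulFlattening 1 id` (`MatMulRankLowerBoundsProofs`) on
the rows `koszulRow₁` and columns `koszulCol₁`. [cite: ConnerGesmundoLandsbergVentura2022, §4.1] -/
theorem koszulFlattening_one_submatrix (t : Fin 3 → κ → μ → R) :
    (koszulFlattening 1 LinearMap.id t).submatrix (fun r : Fin 3 × μ => (koszulRow₁ r.1, r.2))
      (fun c : Fin 3 × κ => (koszulCol₁ c.1, c.2)) = koszulBlock₁ t := by
  ext ⟨p, c⟩ ⟨i, b⟩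
  simp only [Matrix.submatrix_apply, koszulFlattening_apply, LinearMap.id_coe, id_eq,
    koszulBlock₁_apply, wedgeMatrix_apply]
  rw [Fin.sum_univ_three]
  fin_cases p <;> fin_cases i <;> simp +decide [koszulCol₁, koszulSign, Finset.filter_singleton]

end StrassenBlock

/-- **`rank [[0,-T₂,T₁],[-T₂,0,T₀],[-T₁,T₀,0]] ≤ 2 · bR(t')` whenever `t' ≥ t`** (`t ∈ K³ ⊗ K^κ ⊗ K^μ`):
the `p = 1` Koszul bound `bR ≥ rank(T_{A'}^{∧1}) / 2` (`KoszulBorderRank.lean`, LO2015 Thm. 2.1 for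
the algebraic border rank) after a restriction (`BorderRankRestriction.lean`), in block form
(CGLV 2022, §4.1, eq. (5), as used in the proof of Prop. 3.1). [cite: ConnerGesmundoLandsbergVentura2022, §4.1] -/
theorem rank_koszulBlock₁_le_two_mul_algBorderRank {K : Type u} [Field K] {ι : Type v}
    {κ' : Type v'} {μ' : Type w'} {κ μ : Type w} [Fintype ι] [Fintype κ'] [Fintype μ']
    [DecidableEq ι] [DecidableEq κ'] [DecidableEq μ'] [Fintype κ] [Fintype μ] [DecidableEq κ]
    [DecidableEq μ] {t' : ι → κ' → μ' → K} {t : Fin 3 → κ → μ → K} (h : TensorRestrictsTo t' t) :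
    (koszulBlock₁ t).rank ≤ 2 * algBorderRank t' := by
  rw [← koszulFlattening_one_submatrix]
  refine (Matrix.rank_submatrix_le _ _ _).trans ?_
  have h1 := LandsbergOttaviani2015_thm21_algBorderRank 1 LinearMap.id t
  have h2 : algBorderRank t ≤ algBorderRank t' := h.algBorderRank_le
  have h3 : (2 * 1).choose 1 = 2 := by decide
  rw [h3] at h1
  exact h1.trans (Nat.mul_le_mul_left 2 h2)

/-! ## The index set `{0} ⊔ {1,…,u} ⊔ {u+1,…,2u}` of `T_{skewcw,q}`, `q = 2u` -/

section SkewIndex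

/-- The index set of `ℂ^{q+1}`, `q = 2u`, split as `{0} ⊔ {1,…,u} ⊔ {u+1,…,2u}` (the three blocks of
CGLV eq. (3): `a₀`, `a_ξ`, `a_{ξ+u}`, `1 ≤ ξ ≤ u`). [cite: ConnerGesmundoLandsbergVentura2022, eq. (3)] -/
abbrev SkewIdx (u : ℕ) : Type := Unit ⊕ (Fin u ⊕ Fin u)

/-- The embedding of the split index set into `Fin (2u+1)`: `* ↦ 0`, `ξ ↦ ξ + 1`, `ξ' ↦ ξ' + u + 1`
(`ξ, ξ' < u`). [cite: ConnerGesmundoLandsbergVentura2022, eq. (3)] -/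
def skewEmb (u : ℕ) : SkewIdx u → Fin (2 * u + 1)
  | Sum.inl _ => 0
  | Sum.inr (Sum.inl ξ) => ⟨ξ.1 + 1, by omega⟩
  | Sum.inr (Sum.inr ξ) => ⟨ξ.1 + 1 + u, by omega⟩

/-- The three rows `a₀, a_{ξ₀+1}, a_{ξ₀+1+u}` of the first factor kept by the restriction
`A → A' = ℂ³` (a coordinate version of CGLV's projection `φ`, proof of Prop. 3.1).
[cite: ConnerGesmundoLandsbergVentura2022, §4.1 (proof of Prop. 3.1)] -/
def skewRowSel (u : ℕ) (ξ₀ : Fin u) : Fin 3 → Fin (2 * u + 1) :=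
  ![0, skewEmb u (Sum.inr (Sum.inl ξ₀)), skewEmb u (Sum.inr (Sum.inr ξ₀))]

variable (R : Type*) [Ring R] (u : ℕ) (ξ₀ : Fin u)

/-- The slice `T_{skewcw,q}(a₀) = ∑_{j ≥ 1} b_j ⊗ c_j` on the split index set.
[cite: ConnerGesmundoLandsbergVentura2022, eq. (3)] -/
def skewSlice₀ : SkewIdx u → SkewIdx u → R
  | Sum.inr x, Sum.inr y => if x = y then 1 else 0
  | _, _ => 0

/-- The slice `T_{skewcw,q}(a_{ξ₀+1}) = b₀ ⊗ c_{ξ₀+1} + b_{ξ₀+1+u} ⊗ c₀` on the split index set.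
[cite: ConnerGesmundoLandsbergVentura2022, eq. (3)] -/
def skewSlice₁ : SkewIdx u → SkewIdx u → R
  | Sum.inl _, Sum.inr (Sum.inl ξ) => if ξ = ξ₀ then 1 else 0
  | Sum.inr (Sum.inr ξ), Sum.inl _ => if ξ = ξ₀ then 1 else 0
  | _, _ => 0

/-- The slice `T_{skewcw,q}(a_{ξ₀+1+u}) = b₀ ⊗ c_{ξ₀+1+u} - b_{ξ₀+1} ⊗ c₀` on the split index set.
[cite: ConnerGesmundoLandsbergVentura2022, eq. (3)] -/
def skewSlice₂ : SkewIdx u → SkewIdx u → R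
  | Sum.inl _, Sum.inr (Sum.inr ξ) => if ξ = ξ₀ then 1 else 0
  | Sum.inr (Sum.inl ξ), Sum.inl _ => if ξ = ξ₀ then -1 else 0
  | _, _ => 0

/-- The restriction of `T_{skewcw,q}` to the rows `a₀, a_{ξ₀+1}, a_{ξ₀+1+u}` of the first factor
(and the split index set on the other two): a tensor in `R³ ⊗ R^{q+1} ⊗ R^{q+1}` whose three
slices are `skewSlice₀, skewSlice₁, skewSlice₂`. [cite: ConnerGesmundoLandsbergVentura2022, §4.1 (proof of Prop. 3.1)] -/
def skewCwMinor (p : Fin 3) (j j' : SkewIdx u) : R :=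
  ![skewSlice₀ R u j j', skewSlice₁ R u ξ₀ j j', skewSlice₂ R u ξ₀ j j'] p

/-- **The restriction computed**: `T_{skewcw,q}(a_{sel p}, b_{emb j}, c_{emb j'}) = skewCwMinor p j j'`.
[cite: ConnerGesmundoLandsbergVentura2022, eq. (3)] -/
theorem skewCwTensor_rowSel_emb (p : Fin 3) (j j' : SkewIdx u) :
    skewCwTensor R u (skewRowSel u ξ₀ p) (skewEmb u j) (skewEmb u j') = skewCwMinor R u ξ₀ p j j' := by
  fin_cases p <;> rcases j with _ | x | x <;> rcases j' with _ | y | y <;>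
    simp [skewCwTensor, skewRowSel, skewEmb, skewCwMinor, skewSlice₀, skewSlice₁, skewSlice₂,
      Fin.ext_iff] <;>
    (intros; (try split_ifs) <;> first | rfl | omega)

/-- `T_{skewcw,q} ≥ skewCwMinor` (zeroing out / relabelling along index maps).
[cite: ConnerGesmundoLandsbergVentura2022, §4.1 (proof of Prop. 3.1)] -/
theorem tensorRestrictsTo_skewCwMinor (K : Type*) [Field K] :
    TensorRestrictsTo (skewCwTensor K u) (skewCwMinor K u ξ₀) := by
  have h := tensorRestrictsTo_precomp (skewCwTensor K u) (skewRowSel u ξ₀) (skewEmb u) (skewEmb u)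
  have e : (fun a b c => skewCwTensor K u (skewRowSel u ξ₀ a) (skewEmb u b) (skewEmb u c)) =
      skewCwMinor K u ξ₀ := by
    funext p j j'
    exact skewCwTensor_rowSel_emb K u ξ₀ p j j'
  rwa [e] at h

end SkewIndex

/-! ## `rank` of the Koszul block matrix of the restriction is `≥ 2q + 5` -/

section KoszulRank

variable {K : Type*} [Field K] (u : ℕ) (ξ₀ : Fin u)

/-- The positions of the `2q+5` standard basis vectors exhibited in the column span of the Koszul
matrix: `(e₁∧e₂) ⊗ {c₀, c_{ξ₀+1}, c_{ξ₀+1+u}}`, `(e₀∧e₂) ⊗ c_j`, `(e₀∧e₁) ⊗ c_j` (all `j`)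
(CGLV: "the image of `T_{A'}^{∧1}` contains `Λ²A' ⊗ c₀ + e₁∧e₂ ⊗ ⟨…⟩ + ⟨e₀∧e₁, e₀∧e₂⟩ ⊗ ⟨c₁,…,c_q⟩`").
[cite: ConnerGesmundoLandsbergVentura2022, §4.1 (proof of Prop. 3.1)] -/
def skewKoszulIdx : Fin 3 ⊕ (SkewIdx u ⊕ SkewIdx u) → Fin 3 × SkewIdx u
  | Sum.inl p => (0, ![Sum.inl (), Sum.inr (Sum.inl ξ₀), Sum.inr (Sum.inr ξ₀)] p)
  | Sum.inr (Sum.inl j) => (1, j)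
  | Sum.inr (Sum.inr j) => (2, j)

/-- The position map is injective. [folklore] -/
theorem skewKoszulIdx_injective : Function.Injective (skewKoszulIdx u ξ₀) := by
  intro k k' h
  rcases k with p | j | j <;> rcases k' with p' | j' | j' <;>
    simp only [skewKoszulIdx, Prod.mk.injEq] at h
  · rcases h with ⟨-, h⟩
    fin_cases p <;> fin_cases p' <;> simp_all
  all_goals first
    | exact absurd h.1 (by decide)
    | (rcases h with ⟨-, rfl⟩; rfl)

/-- The Koszul block matrix of the restricted skew tensor (`p = 1`, `dim A' = 3`). [cite: ConnerGesmundoLandsbergVentura2022, §4.1 (proof of Prop. 3.1)] -/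
abbrev skewKoszul : Matrix (Fin 3 × SkewIdx u) (Fin 3 × SkewIdx u) K :=
  koszulBlock₁ (skewCwMinor K u ξ₀)

/-- Column `(e₁, b₀)`: `-(e₁∧e₂) ⊗ c_{ξ₀+1+u}`. [cite: ConnerGesmundoLandsbergVentura2022, §4.1 (proof of Prop. 3.1)] -/
theorem skewKoszul_col_one_inl :
    (skewKoszul (K := K) u ξ₀).col (1, Sum.inl ()) = -Pi.single (0, Sum.inr (Sum.inr ξ₀)) 1 := by
  funext ⟨p, j'⟩
  fin_cases p <;> rcases j' with _ | y | y <;>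
    simp [koszulBlock₁_apply, skewCwMinor, skewSlice₀, skewSlice₁, skewSlice₂, Pi.single_apply,
      eq_comm]

/-- Column `(e₂, b₀)`: `(e₁∧e₂) ⊗ c_{ξ₀+1}`. [cite: ConnerGesmundoLandsbergVentura2022, §4.1 (proof of Prop. 3.1)] -/
theorem skewKoszul_col_two_inl :
    (skewKoszul (K := K) u ξ₀).col (2, Sum.inl ()) = Pi.single (0, Sum.inr (Sum.inl ξ₀)) 1 := by
  funext ⟨p, j'⟩
  fin_cases p <;> rcases j' with _ | y | y <;>
    simp [koszulBlock₁_apply, skewCwMinor, skewSlice₀, skewSlice₁, skewSlice₂, Pi.single_apply,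
      eq_comm]

/-- Column `(e₀, b₀)`: `-(e₀∧e₂) ⊗ c_{ξ₀+1+u} - (e₀∧e₁) ⊗ c_{ξ₀+1}`. [cite: ConnerGesmundoLandsbergVentura2022, §4.1 (proof of Prop. 3.1)] -/
theorem skewKoszul_col_zero_inl :
    (skewKoszul (K := K) u ξ₀).col (0, Sum.inl ()) =
      -Pi.single (1, Sum.inr (Sum.inr ξ₀)) 1 - Pi.single (2, Sum.inr (Sum.inl ξ₀)) 1 := by
  funext ⟨p, j'⟩
  fin_cases p <;> rcases j' with _ | y | y <;>
    simp [koszulBlock₁_apply, skewCwMinor, skewSlice₀, skewSlice₁, skewSlice₂, Pi.single_apply,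
      eq_comm]

/-- Column `(e₁, b_{ξ₀+1})`: `(e₁∧e₂) ⊗ c₀ + (e₀∧e₁) ⊗ c_{ξ₀+1}`. [cite: ConnerGesmundoLandsbergVentura2022, §4.1 (proof of Prop. 3.1)] -/
theorem skewKoszul_col_one_mid :
    (skewKoszul (K := K) u ξ₀).col (1, Sum.inr (Sum.inl ξ₀)) =
      Pi.single (0, Sum.inl ()) 1 + Pi.single (2, Sum.inr (Sum.inl ξ₀)) 1 := by
  funext ⟨p, j'⟩
  fin_cases p <;> rcases j' with _ | y | y <;>
    simp [koszulBlock₁_apply, skewCwMinor, skewSlice₀, skewSlice₁, skewSlice₂, Pi.single_apply,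
      eq_comm]

/-- Column `(e₂, b_{ξ₀+1+u})`: `(e₁∧e₂) ⊗ c₀ + (e₀∧e₂) ⊗ c_{ξ₀+1+u}`. [cite: ConnerGesmundoLandsbergVentura2022, §4.1 (proof of Prop. 3.1)] -/
theorem skewKoszul_col_two_top :
    (skewKoszul (K := K) u ξ₀).col (2, Sum.inr (Sum.inr ξ₀)) =
      Pi.single (0, Sum.inl ()) 1 + Pi.single (1, Sum.inr (Sum.inr ξ₀)) 1 := by
  funext ⟨p, j'⟩
  fin_cases p <;> rcases j' with _ | y | y <;>
    simp [koszulBlock₁_apply, skewCwMinor, skewSlice₀, skewSlice₁, skewSlice₂, Pi.single_apply,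
      eq_comm]

/-- Column `(e₀, b_{ξ₀+1})`: `(e₀∧e₂) ⊗ c₀`. [cite: ConnerGesmundoLandsbergVentura2022, §4.1 (proof of Prop. 3.1)] -/
theorem skewKoszul_col_zero_mid :
    (skewKoszul (K := K) u ξ₀).col (0, Sum.inr (Sum.inl ξ₀)) = Pi.single (1, Sum.inl ()) 1 := by
  funext ⟨p, j'⟩
  fin_cases p <;> rcases j' with _ | y | y <;>
    simp [koszulBlock₁_apply, skewCwMinor, skewSlice₀, skewSlice₁, skewSlice₂, eq_comm]

/-- Column `(e₀, b_{ξ₀+1+u})`: `-(e₀∧e₁) ⊗ c₀`. [cite: ConnerGesmundoLandsbergVentura2022, §4.1 (proof of Prop. 3.1)] -/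
theorem skewKoszul_col_zero_top :
    (skewKoszul (K := K) u ξ₀).col (0, Sum.inr (Sum.inr ξ₀)) = -Pi.single (2, Sum.inl ()) 1 := by
  funext ⟨p, j'⟩
  fin_cases p <;> rcases j' with _ | y | y <;>
    simp [koszulBlock₁_apply, skewCwMinor, skewSlice₀, skewSlice₁, skewSlice₂, eq_comm]

/-- Columns `(e₂, b_j)`, `j ≠ 0`: `(e₀∧e₂) ⊗ c_j` plus `(e₁∧e₂) ⊗ c₀` if `j = ξ₀+1+u`.
[cite: ConnerGesmundoLandsbergVentura2022, §4.1 (proof of Prop. 3.1)] -/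
theorem skewKoszul_col_two_inr (x : Fin u ⊕ Fin u) :
    (skewKoszul (K := K) u ξ₀).col (2, Sum.inr x) =
      Pi.single (1, Sum.inr x) 1 +
        if x = Sum.inr ξ₀ then Pi.single (0, Sum.inl ()) 1 else 0 := by
  funext ⟨p, j'⟩
  fin_cases p <;> rcases j' with _ | y | y <;> rcases x with x | x <;>
    simp [koszulBlock₁_apply, skewCwMinor, skewSlice₀, skewSlice₁, skewSlice₂, Pi.single_apply,
      eq_comm] <;> split_ifs <;> simp_all

/-- Columns `(e₁, b_j)`, `j ≠ 0`: `(e₀∧e₁) ⊗ c_j` plus `(e₁∧e₂) ⊗ c₀` if `j = ξ₀+1`.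
[cite: ConnerGesmundoLandsbergVentura2022, §4.1 (proof of Prop. 3.1)] -/
theorem skewKoszul_col_one_inr (x : Fin u ⊕ Fin u) :
    (skewKoszul (K := K) u ξ₀).col (1, Sum.inr x) =
      Pi.single (2, Sum.inr x) 1 +
        if x = Sum.inl ξ₀ then Pi.single (0, Sum.inl ()) 1 else 0 := by
  funext ⟨p, j'⟩
  fin_cases p <;> rcases j' with _ | y | y <;> rcases x with x | x <;>
    simp [koszulBlock₁_apply, skewCwMinor, skewSlice₀, skewSlice₁, skewSlice₂, Pi.single_apply,
      eq_comm] <;> split_ifs <;> simp_all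

/-- **`rank T_{A'}^{∧1} ≥ 2q + 5`** for the restricted skew tensor (`char K ≠ 2`): its column span
contains the `2q + 5 = 4u + 5` standard basis vectors at the positions `skewKoszulIdx`
(CGLV: "`rank(T_{A'}^{∧1}) ≥ 3 + 2 + 2q = 2q + 5`"). [cite: ConnerGesmundoLandsbergVentura2022, §4.1 (proof of Prop. 3.1)] -/
theorem rank_skewKoszul_ge (h2 : (2 : K) ≠ 0) : 4 * u + 5 ≤ (skewKoszul (K := K) u ξ₀).rank := by
  classical
  set B := skewKoszul (K := K) u ξ₀ with hB
  set W : Submodule K (Fin 3 × SkewIdx u → K) := span K (Set.range B.col) with hW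
  have hcol : ∀ c, B.col c ∈ W := fun c => subset_span ⟨c, rfl⟩
  -- `(e₁∧e₂) ⊗ c₀` is reached with coefficient `2`
  have h0 : (Pi.single (0, Sum.inl ()) 1 : Fin 3 × SkewIdx u → K) ∈ W := by
    have hsum : B.col (1, Sum.inr (Sum.inl ξ₀)) + B.col (2, Sum.inr (Sum.inr ξ₀)) +
        B.col (0, Sum.inl ()) = (2 : K) • Pi.single (0, Sum.inl ()) 1 := by
      rw [hB, skewKoszul_col_one_mid, skewKoszul_col_two_top, skewKoszul_col_zero_inl, two_smul]
      abel
    have hmem : (2 : K) • (Pi.single (0, Sum.inl ()) 1 : Fin 3 × SkewIdx u → K) ∈ W := by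
      rw [← hsum]
      exact W.add_mem (W.add_mem (hcol _) (hcol _)) (hcol _)
    have := W.smul_mem (2 : K)⁻¹ hmem
    rwa [smul_smul, inv_mul_cancel₀ h2, one_smul] at this
  -- all the exhibited basis vectors lie in `W`
  have hmem : ∀ k, (Pi.single (skewKoszulIdx u ξ₀ k) 1 : Fin 3 × SkewIdx u → K) ∈ W := by
    rintro (p | j | j)
    · fin_cases p
      · simpa [skewKoszulIdx] using h0
      · have := hcol (2, Sum.inl ())
        rw [hB, skewKoszul_col_two_inl] at this
        simpa [skewKoszulIdx] using this
      · have := W.neg_mem (hcol (1, Sum.inl ()))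
        rw [hB, skewKoszul_col_one_inl, neg_neg] at this
        simpa [skewKoszulIdx] using this
    · show (Pi.single (1, j) 1 : Fin 3 × SkewIdx u → K) ∈ W
      rcases j with _ | x
      · have := hcol (0, Sum.inr (Sum.inl ξ₀))
        rwa [hB, skewKoszul_col_zero_mid] at this
      · have := W.sub_mem (hcol (2, Sum.inr x))
          (W.smul_mem (if x = Sum.inr ξ₀ then (1 : K) else 0) h0)
        rw [hB, skewKoszul_col_two_inr] at this
        convert this using 1
        split_ifs <;> simp
    · show (Pi.single (2, j) 1 : Fin 3 × SkewIdx u → K) ∈ W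
      rcases j with _ | x
      · have := W.neg_mem (hcol (0, Sum.inr (Sum.inr ξ₀)))
        rwa [hB, skewKoszul_col_zero_top, neg_neg] at this
      · have := W.sub_mem (hcol (1, Sum.inr x))
          (W.smul_mem (if x = Sum.inl ξ₀ then (1 : K) else 0) h0)
        rw [hB, skewKoszul_col_one_inr] at this
        convert this using 1
        split_ifs <;> simp
  -- they are linearly independent
  have hli : LinearIndependent K
      (fun k => (Pi.single (skewKoszulIdx u ξ₀ k) 1 : Fin 3 × SkewIdx u → K)) := by
    have := (Pi.basisFun K (Fin 3 × SkewIdx u)).linearIndependent.comp _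
      (skewKoszulIdx_injective u ξ₀)
    convert this using 1
    funext k
    simp [Function.comp, Pi.basisFun_apply]
  have hle : span K (Set.range fun k => (Pi.single (skewKoszulIdx u ξ₀ k) 1 :
      Fin 3 × SkewIdx u → K)) ≤ W := by
    rw [span_le]
    rintro _ ⟨k, rfl⟩
    exact hmem k
  have hcard : Fintype.card (Fin 3 ⊕ (SkewIdx u ⊕ SkewIdx u)) = 4 * u + 5 := by
    simp only [Fintype.card_sum, Fintype.card_fin, Fintype.card_unit]
    ring
  calc 4 * u + 5 = Fintype.card (Fin 3 ⊕ (SkewIdx u ⊕ SkewIdx u)) := hcard.symm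
    _ = finrank K (span K (Set.range fun k =>
          (Pi.single (skewKoszulIdx u ξ₀ k) 1 : Fin 3 × SkewIdx u → K))) :=
        (finrank_span_eq_card hli).symm
    _ ≤ finrank K W := Submodule.finrank_mono hle
    _ = B.rank := (Matrix.rank_eq_finrank_span_cols B).symm

/-- **CGLV Prop. 3.1, lower bound**: `bR(T_{skewcw,q}) ≥ q + 3` for even `q = 2u ≥ 2`, over any field
of characteristic `≠ 2`, for the algebraic border rank: `2 · bR ≥ rank T_{A'}^{∧1} ≥ 2q + 5`.
[cite: ConnerGesmundoLandsbergVentura2022, Prop. 3.1] -/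
theorem add_three_le_algBorderRank_skewCwTensor (h2 : (2 : K) ≠ 0) {u : ℕ} (hu : 0 < u) :
    2 * u + 3 ≤ algBorderRank (skewCwTensor K u) := by
  have hres := tensorRestrictsTo_skewCwMinor u ⟨0, hu⟩ K
  have h1 := rank_koszulBlock₁_le_two_mul_algBorderRank hres
  have h2' := rank_skewKoszul_ge u ⟨0, hu⟩ h2
  have h3 : 4 * u + 5 ≤ 2 * algBorderRank (skewCwTensor K u) := h2'.trans h1
  omega

end KoszulRank

/-! ## `R(T_{skewcw,2}) ≤ 5`: an explicit five-term decomposition -/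

section RankFive

variable (K : Type*) [CommRing K]

/-- First factors of a five-term decomposition of `T_{skewcw,2}`. [folklore] -/
def skewCwFive₁ : Fin 5 → Fin 3 → K :=
  ![![0, -1, 0], ![-1, 0, -1], ![1, 0, 0], ![0, 1, 1], ![1, 1, 1]]

/-- Second factors of a five-term decomposition of `T_{skewcw,2}`. [folklore] -/
def skewCwFive₂ : Fin 5 → Fin 3 → K :=
  ![![-1, 0, 0], ![0, 1, 1], ![0, 1, 0], ![-1, 0, 1], ![0, 0, 1]]

/-- Third factors of a five-term decomposition of `T_{skewcw,2}`. [folklore] -/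
def skewCwFive₃ : Fin 5 → Fin 3 → K :=
  ![![0, 1, -1], ![1, 0, 0], ![1, 1, 0], ![0, 0, -1], ![1, 0, 1]]

/-- **`T_{skewcw,2}` is a sum of five triads** (so `R(T_{skewcw,2}) ≤ 5`; CGLV §2.2: `T_{skewcw,2}`
is `a₀ ∧ a₁ ∧ a₂` after a change of bases, and "for all `T ∈ ℂ³⊗ℂ³⊗ℂ³`, `bR(T) ≤ 5`"; the explicit
decomposition below is not printed there and is checked entrywise):
`T_{skewcw,2} = e₁⊗e₀⊗(e₁-e₂) - (e₀+e₂)⊗(e₁+e₂)⊗e₀ + e₀⊗e₁⊗(e₀+e₁) + (e₁+e₂)⊗(e₀-e₂)⊗e₂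
  + (e₀+e₁+e₂)⊗e₂⊗(e₀+e₂)`. [cite: ConnerGesmundoLandsbergVentura2022, §2.2 (bR(T_skewcw,2) = 5)] -/
theorem skewCwTensor_one_eq_sum :
    skewCwTensor K 1 = ∑ i, triad (skewCwFive₁ K i) (skewCwFive₂ K i) (skewCwFive₃ K i) := by
  funext a b c
  rw [sum_triad_apply, Fin.sum_univ_five]
  fin_cases a <;> fin_cases b <;> fin_cases c <;>
    simp [skewCwTensor, skewCwFive₁, skewCwFive₂, skewCwFive₃]

/-- `R(T_{skewcw,2}) ≤ 5`. [cite: ConnerGesmundoLandsbergVentura2022, §2.2 (bR(T_skewcw,2) = 5)] -/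
theorem tensorRank_skewCwTensor_one_le : tensorRank (skewCwTensor K 1) ≤ 5 :=
  tensorRank_le_of_eq_sum _ _ _ (skewCwTensor_one_eq_sum K)

end RankFive

/-! ## Discharge of `CGLV2022_prop31` -/

/-- **CGLV Prop. 3.1 with `bR(T_{skewcw,2}) = 5`, proved** (discharge of `CGLV2022_prop31`): the
lower bound by the `p = 1` Koszul flattening of the restriction to `⟨a₀, a₁, a_{u+1}⟩`
(`add_three_le_algBorderRank_skewCwTensor`), the upper bound `bR ≤ R ≤ 5` by the explicit
five-term decomposition. [cite: ConnerGesmundoLandsbergVentura2022, Prop. 3.1] -/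
theorem CGLV2022_prop31_holds : CGLV2022_prop31 := by
  refine ⟨fun u hu => add_three_le_algBorderRank_skewCwTensor (K := ℂ) two_ne_zero hu, ?_⟩
  refine le_antisymm ?_ ?_
  · exact (algBorderRank_le_tensorRank _).trans (tensorRank_skewCwTensor_one_le ℂ)
  · have := add_three_le_algBorderRank_skewCwTensor (K := ℂ) two_ne_zero (u := 1) one_pos
    simpa using this

end Literature.Computability.AlgebraicComplexity

end
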